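import Mathlib
import Literature.Probability.LatticeModels.TorusFourierWeightedL1Prod
import Literature.Probability.LatticeModels.TorusFourierBernstein
import HarnessLib

/-!
# Bernstein's theorem on a PRODUCT of discrete tori (space-time lattice kernels): moments from two orders of differences

Topic `Probability/LatticeModels`; the product-torus form of `TorusFourierBernstein.lean` (one torus `(ℤ/Lℤ)^d`), built on
`TorusFourierWeightedL1Prod` (weighted Plancherel for character sums `S(a,b) = Σ_{p,p'} χ_p(a) χ_{p'}(b) G(p,p')` over
`(ℤ/L₁ℤ)^{d₁} × (ℤ/L₂ℤ)^{d₂}`) and the abstract dyadic interpolation of `TorusFourierDyadicInterpolation`.  This is the shape in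
which a finite-temperature lattice propagator on the discrete space-time torus appears — time dual torus `(ℤ/Pℤ)¹` of the
Matsubara frequencies times the momentum torus `(ℤ/Lℤ)²` — and the point of the file is the FIRST MOMENT of such a kernel in
`2+1` dimensions from its second and third differences (`(a, d₁+d₂, j₁, j₂) = (1, 3, 2, 3)`), which the one-weight
Cauchy–Schwarz route of `TorusFourierWeightedL1ProdWeight` cannot deliver from three differences or fewer.

The two factors carry different physical meshes: a step of the first (time) index is worth `κ ≤ 1` steps of the second
(space) lattice (`κ = β/P` for `P` time slices of an interval of length `β`, in spatial lattice units).  Accordingly the radius is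
`r(a,b) = max(κ|ã|_∞, |b̃|_∞)`, the counting weight is `μ = κ^{d₁}` (a time sum is worth `κ` per point), the volume growth is
`Σ_{r < R} μ ≤ 3^{d₁+d₂} R^{d₁+d₂}` (`card_filter_prodRadius_lt_mul_le`), and pure `j`-th differences along the axes of either
factor
pay the tails with the SCALED mesh factors `(κL₁/4)^{2j}` (first factor) and `(L₂/4)^{2j}` (second factor)
(`sum_filter_prodRadius_pow_mul_norm_sq_le`; for `κ = β/P` the time factor is `(β/4)^{2j}`, so that the samples of a symbol
smooth on the physical scales `2π/β` and `2π/L` have `L`- and `P`-uniform tail constants).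

* **`sum_prodRadius_pow_mul_norm_le_sqrt`** — over `{r ≥ 1}`: with `2j₁ + m = 2a + d = 2j₂ - m` (`d = d₁ + d₂`, `m ≥ 1`,
  `θ = √2`) and `(κL₁/4)^{2j} Σ_i ‖Δ^{j}_{(e_i,0)} G‖²_{ℓ²} + (L₂/4)^{2j} Σ_i ‖Δ^{j}_{(0,e_i)} G‖²_{ℓ²} ≤ T_j²` (`j = j₁, j₂`),
  `Σ_{r ≥ 1} r^a ‖S(a,b)‖ ≤ 2 θ^{2a+d} θ^m/(θ^m-1) · √(3^d) · √(L₁^{d₁} L₂^{d₂} / κ^{d₁}) · √(T_{j₁} T_{j₂})`;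
* **`sum_prodRadius_pow_mul_norm_le_sqrt_add`** — the FULL sum (the near region `{r < 1}` = times shorter than one spatial
  spacing is paid by the plain `ℓ²` size `Σ ‖G‖² ≤ T₀²`):
  `Σ_{a,b} r^a ‖S(a,b)‖ ≤ √(3^d) · √(L₁^{d₁} L₂^{d₂} / κ^{d₁}) · (T₀ + 2 θ^{2a+d} θ^m/(θ^m-1) √(T_{j₁} T_{j₂}))`.
  In the physical normalisation (`d₁ = 1`, `κ = β/P`, kernel `(βL^{d₂})⁻¹ S`, measure `κ Σ_{a,b}`) the right-hand side reads
  `(P L^{d₂})^{-1/2} · [T₀ + C √(T_{j₁}T_{j₂})]`, uniform in `(β, L, P)` when the `T`'s are the `ℓ²` sizes of a UV-cut-off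
  propagator symbol.

Everything is proved; no definitions, no named facts.

## Sources

Y. Katznelson, *An Introduction to Harmonic Analysis*, 3rd ed., CUP 2004, Ch. I §6.3 (Bernstein's theorem, dyadic proof),
pp. 57–58 [`Katznelson2004`]; G. Benfatto, A. Giuliani, V. Mastropietro, Ann. Henri Poincaré 7 (2006) 809–898, Lemma 2.2,
(2.36aa) and footnote ¹ (lattice propagators at finite `(β, L)`) [`BenfattoGiulianiMastropietro2006`].
-/

noncomputable section

open Finset

namespace Literature.Probability.LatticeModels

section Prod

open Complex
open scoped Real ComplexConjugate

variable {d₁ L₁ d₂ L₂ : ℕ} [NeZero L₁] [NeZero L₂]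

omit [NeZero L₁] in
/-- `|ã|_∞^n ≤ Σ_i |ã_i|^n` on `{|ã|_∞ ≥ t}` for any `t > 0` (the sup is attained). [folklore] -/
private theorem sup_pow_le_sum_pow_of_pos (a : TorusSite d₁ L₁) (n : ℕ) {t : ℝ} (ht : 0 < t)
    (ha : t ≤ (((univ : Finset (Fin d₁)).sup (fun i => (a i).valMinAbs.natAbs) : ℕ) : ℝ)) :
    ((((univ : Finset (Fin d₁)).sup (fun i => (a i).valMinAbs.natAbs) : ℕ) : ℝ)) ^ n ≤
      ∑ i : Fin d₁, ((a i).valMinAbs.natAbs : ℝ) ^ n := by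
  have hne : (univ : Finset (Fin d₁)).Nonempty := by
    rcases Nat.eq_zero_or_pos d₁ with hd | hd
    · subst hd
      exfalso
      have h0 : (univ : Finset (Fin 0)).sup (fun i => (a i).valMinAbs.natAbs) = 0 := by simp
      rw [h0] at ha
      norm_num at ha
      linarith
    · exact ⟨⟨0, hd⟩, mem_univ _⟩
  obtain ⟨i, -, hi⟩ := Finset.exists_mem_eq_sup univ hne (fun i => (a i).valMinAbs.natAbs)
  rw [hi]
  exact single_le_sum (f := fun i => ((a i).valMinAbs.natAbs : ℝ) ^ n) (fun i _ => by positivity) (mem_univ i)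

/-- **Volume growth of the anisotropic product radius** `r(a,b) = max(κ|ã|_∞, |b̃|_∞)` with weight `κ^{d₁}`, `0 < κ ≤ 1`:
`Σ_{r < R} κ^{d₁} ≤ 3^{d₁+d₂} R^{d₁+d₂}` for `R ≥ 1` (the product of the two sup-norm ball counts, the first at radius
`R/κ`). [cite: Katznelson2004, Ch. I §6.3, proof of Theorem (Bernstein), (6.5)] -/
theorem card_filter_prodRadius_lt_mul_le {κ : ℝ} (hκ0 : 0 < κ) (hκ1 : κ ≤ 1) {R : ℝ} (hR : 1 ≤ R) :
    ((((univ : Finset (TorusSite d₁ L₁ × TorusSite d₂ L₂)).filter (fun x =>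
        max (κ * (((univ : Finset (Fin d₁)).sup (fun i => (x.1 i).valMinAbs.natAbs) : ℕ) : ℝ))
          ((((univ : Finset (Fin d₂)).sup (fun i => (x.2 i).valMinAbs.natAbs) : ℕ) : ℝ)) < R)).card : ℕ) : ℝ) * κ ^ d₁ ≤
      (3 : ℝ) ^ (d₁ + d₂) * R ^ (d₁ + d₂) := by
  classical
  have hfilter : (univ : Finset (TorusSite d₁ L₁ × TorusSite d₂ L₂)).filter (fun x =>
        max (κ * (((univ : Finset (Fin d₁)).sup (fun i => (x.1 i).valMinAbs.natAbs) : ℕ) : ℝ))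
          ((((univ : Finset (Fin d₂)).sup (fun i => (x.2 i).valMinAbs.natAbs) : ℕ) : ℝ)) < R) =
      (univ : Finset (TorusSite d₁ L₁)).filter
          (fun a => (((univ : Finset (Fin d₁)).sup (fun i => (a i).valMinAbs.natAbs) : ℕ) : ℝ) < R / κ) ×ˢ
        (univ : Finset (TorusSite d₂ L₂)).filter
          (fun b => (((univ : Finset (Fin d₂)).sup (fun i => (b i).valMinAbs.natAbs) : ℕ) : ℝ) < R) := by
    rw [← filter_product, univ_product_univ]
    refine filter_congr fun x _ => ?_
    rw [max_lt_iff, lt_div_iff₀ hκ0, mul_comm]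
  rw [hfilter, card_product, Nat.cast_mul]
  have hRκ : 1 ≤ R / κ := by rw [le_div_iff₀ hκ0]; linarith
  have h1 := card_filter_supNorm_lt_le (d := d₁) (L := L₁) hRκ
  have h2 := card_filter_supNorm_lt_le (d := d₂) (L := L₂) hR
  calc ((((univ : Finset (TorusSite d₁ L₁)).filter
          (fun a => (((univ : Finset (Fin d₁)).sup (fun i => (a i).valMinAbs.natAbs) : ℕ) : ℝ) < R / κ)).card : ℕ) : ℝ) *
        ((((univ : Finset (TorusSite d₂ L₂)).filter
          (fun b => (((univ : Finset (Fin d₂)).sup (fun i => (b i).valMinAbs.natAbs) : ℕ) : ℝ) < R)).card : ℕ) : ℝ) * κ ^ d₁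
      ≤ ((3 : ℝ) ^ d₁ * (R / κ) ^ d₁) * ((3 : ℝ) ^ d₂ * R ^ d₂) * κ ^ d₁ := by gcongr
    _ = (3 : ℝ) ^ (d₁ + d₂) * R ^ (d₁ + d₂) := by
        rw [div_pow, pow_add, pow_add]
        field_simp

/-- Pure differences along an axis of the FIRST factor pay the scaled weight `(κ|ã_i|)^{2N}`:
`Σ_{a,b} (κ|ã_i|)^{2N} ‖S(a,b)‖² ≤ (κL₁/4)^{2N} L₁^{d₁}L₂^{d₂} Σ_{p,p'} ‖(Δ_{e_i}^N G(·,p'))(p)‖²`.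
[cite: BenfattoGiulianiMastropietro2006, Lemma 2.2 and (2.36aa)] -/
theorem sum_sum_pow_valMinAbs_fst_mul_norm_sq_le (G : TorusSite d₁ L₁ → TorusSite d₂ L₂ → ℂ) {κ : ℝ} (hκ : 0 ≤ κ)
    (i : Fin d₁) (N : ℕ) :
    ∑ a : TorusSite d₁ L₁, ∑ b : TorusSite d₂ L₂,
        (κ * ((a i).valMinAbs.natAbs : ℝ)) ^ (2 * N) * ‖∑ p, ∑ p', torusChar p a * torusChar p' b * G p p'‖ ^ 2 ≤
      (κ * L₁ / 4) ^ (2 * N) *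
        ((L₁ : ℝ) ^ d₁ * (L₂ : ℝ) ^ d₂ * ∑ p, ∑ p', ‖((fwdDiff (Pi.single i 1))^[N] (fun q => G q p')) p‖ ^ 2) := by
  have hL : (0 : ℝ) < L₁ := Nat.cast_pos.2 (Nat.pos_of_ne_zero (NeZero.ne L₁))
  have hw := sum_sum_weight_fst_mul_norm_sq_le G (Pi.single i 1) N
  have hsingle : ∀ a : TorusSite d₁ L₁, (∑ j, (Pi.single i (1 : ZMod L₁) : TorusSite d₁ L₁) j * a j) = a i := by
    intro a
    rw [Finset.sum_eq_single i (fun j _ hj => by rw [Pi.single_eq_of_ne hj, zero_mul])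
      (fun hi => absurd (mem_univ i) hi), Pi.single_eq_same, one_mul]
  simp_rw [hsingle] at hw
  calc ∑ a : TorusSite d₁ L₁, ∑ b : TorusSite d₂ L₂,
        (κ * ((a i).valMinAbs.natAbs : ℝ)) ^ (2 * N) * ‖∑ p, ∑ p', torusChar p a * torusChar p' b * G p p'‖ ^ 2
      = (κ * L₁ / 4) ^ (2 * N) * ∑ a : TorusSite d₁ L₁, ∑ b : TorusSite d₂ L₂,
          (4 * |((a i).valMinAbs : ℝ)| / L₁) ^ (2 * N) * ‖∑ p, ∑ p', torusChar p a * torusChar p' b * G p p'‖ ^ 2 := by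
        rw [mul_sum]
        refine sum_congr rfl fun a _ => ?_
        rw [mul_sum]
        refine sum_congr rfl fun b _ => ?_
        rw [← mul_assoc, ← mul_pow, Nat.cast_natAbs, Int.cast_abs]
        congr 2
        field_simp
    _ ≤ (κ * L₁ / 4) ^ (2 * N) *
        ((L₁ : ℝ) ^ d₁ * (L₂ : ℝ) ^ d₂ * ∑ p, ∑ p', ‖((fwdDiff (Pi.single i 1))^[N] (fun q => G q p')) p‖ ^ 2) :=
        mul_le_mul_of_nonneg_left hw (by positivity)

/-- Pure differences along an axis of the SECOND factor pay the weight `|b̃_i|^{2N}`: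
`Σ_{a,b} |b̃_i|^{2N} ‖S(a,b)‖² ≤ (L₂/4)^{2N} L₁^{d₁}L₂^{d₂} Σ_{p,p'} ‖(Δ_{e_i}^N G(p,·))(p')‖²`.
[cite: BenfattoGiulianiMastropietro2006, Lemma 2.2 and (2.36aa)] -/
theorem sum_sum_pow_valMinAbs_snd_mul_norm_sq_le (G : TorusSite d₁ L₁ → TorusSite d₂ L₂ → ℂ) (i : Fin d₂) (N : ℕ) :
    ∑ a : TorusSite d₁ L₁, ∑ b : TorusSite d₂ L₂,
        ((b i).valMinAbs.natAbs : ℝ) ^ (2 * N) * ‖∑ p, ∑ p', torusChar p a * torusChar p' b * G p p'‖ ^ 2 ≤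
      ((L₂ : ℝ) / 4) ^ (2 * N) *
        ((L₁ : ℝ) ^ d₁ * (L₂ : ℝ) ^ d₂ * ∑ p, ∑ p', ‖((fwdDiff (Pi.single i 1))^[N] (G p)) p'‖ ^ 2) := by
  have hL : (0 : ℝ) < L₂ := Nat.cast_pos.2 (Nat.pos_of_ne_zero (NeZero.ne L₂))
  have hw := sum_sum_weight_snd_mul_norm_sq_le G (Pi.single i 1) N
  have hsingle : ∀ b : TorusSite d₂ L₂, (∑ j, (Pi.single i (1 : ZMod L₂) : TorusSite d₂ L₂) j * b j) = b i := by
    intro b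
    rw [Finset.sum_eq_single i (fun j _ hj => by rw [Pi.single_eq_of_ne hj, zero_mul])
      (fun hi => absurd (mem_univ i) hi), Pi.single_eq_same, one_mul]
  simp_rw [hsingle] at hw
  calc ∑ a : TorusSite d₁ L₁, ∑ b : TorusSite d₂ L₂,
        ((b i).valMinAbs.natAbs : ℝ) ^ (2 * N) * ‖∑ p, ∑ p', torusChar p a * torusChar p' b * G p p'‖ ^ 2
      = ((L₂ : ℝ) / 4) ^ (2 * N) * ∑ a : TorusSite d₁ L₁, ∑ b : TorusSite d₂ L₂,
          (4 * |((b i).valMinAbs : ℝ)| / L₂) ^ (2 * N) * ‖∑ p, ∑ p', torusChar p a * torusChar p' b * G p p'‖ ^ 2 := by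
        rw [mul_sum]
        refine sum_congr rfl fun a _ => ?_
        rw [mul_sum]
        refine sum_congr rfl fun b _ => ?_
        rw [← mul_assoc, ← mul_pow, Nat.cast_natAbs, Int.cast_abs]
        congr 2
        field_simp
    _ ≤ ((L₂ : ℝ) / 4) ^ (2 * N) *
        ((L₁ : ℝ) ^ d₁ * (L₂ : ℝ) ^ d₂ * ∑ p, ∑ p', ‖((fwdDiff (Pi.single i 1))^[N] (G p)) p'‖ ^ 2) :=
        mul_le_mul_of_nonneg_left hw (by positivity)

/-- **The tail constants of the product radius from pure differences**: on `{r ≥ 1}`, `r = max(κ|ã|_∞, |b̃|_∞)`, `0 < κ`,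
`Σ_{r ≥ 1} κ^{d₁} r^{2j} ‖S(a,b)‖² ≤ κ^{d₁} L₁^{d₁} L₂^{d₂} ((κL₁/4)^{2j} Σ_i Σ ‖Δ^{j}_{(e_i,0)} G‖² + (L₂/4)^{2j} Σ_i Σ
‖Δ^{j}_{(0,e_i)} G‖²)`.
[cite: Katznelson2004, Ch. I §6.3, (6.4)] -/
theorem sum_filter_prodRadius_pow_mul_norm_sq_le (G : TorusSite d₁ L₁ → TorusSite d₂ L₂ → ℂ) {κ : ℝ} (hκ0 : 0 < κ)
    (j : ℕ) :
    ∑ x ∈ (univ : Finset (TorusSite d₁ L₁ × TorusSite d₂ L₂)).filter (fun x => (1 : ℝ) ≤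
        max (κ * (((univ : Finset (Fin d₁)).sup (fun i => (x.1 i).valMinAbs.natAbs) : ℕ) : ℝ))
          ((((univ : Finset (Fin d₂)).sup (fun i => (x.2 i).valMinAbs.natAbs) : ℕ) : ℝ))),
      κ ^ d₁ * (max (κ * (((univ : Finset (Fin d₁)).sup (fun i => (x.1 i).valMinAbs.natAbs) : ℕ) : ℝ))
          ((((univ : Finset (Fin d₂)).sup (fun i => (x.2 i).valMinAbs.natAbs) : ℕ) : ℝ))) ^ (2 * j) *
        ‖∑ p, ∑ p', torusChar p x.1 * torusChar p' x.2 * G p p'‖ ^ 2 ≤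
      κ ^ d₁ * ((L₁ : ℝ) ^ d₁ * (L₂ : ℝ) ^ d₂) *
        ((κ * L₁ / 4) ^ (2 * j) * ∑ i : Fin d₁, ∑ p, ∑ p', ‖((fwdDiff (Pi.single i 1))^[j] (fun q => G q p')) p‖ ^ 2 +
          ((L₂ : ℝ) / 4) ^ (2 * j) * ∑ i : Fin d₂, ∑ p, ∑ p', ‖((fwdDiff (Pi.single i 1))^[j] (G p)) p'‖ ^ 2) := by
  -- pointwise: `r^{2j} ≤ Σ_i (κ|ã_i|)^{2j} + Σ_i |b̃_i|^{2j}` on `{r ≥ 1}`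
  have hpt : ∀ x ∈ (univ : Finset (TorusSite d₁ L₁ × TorusSite d₂ L₂)).filter (fun x => (1 : ℝ) ≤
      max (κ * (((univ : Finset (Fin d₁)).sup (fun i => (x.1 i).valMinAbs.natAbs) : ℕ) : ℝ))
        ((((univ : Finset (Fin d₂)).sup (fun i => (x.2 i).valMinAbs.natAbs) : ℕ) : ℝ))),
      (max (κ * (((univ : Finset (Fin d₁)).sup (fun i => (x.1 i).valMinAbs.natAbs) : ℕ) : ℝ))
          ((((univ : Finset (Fin d₂)).sup (fun i => (x.2 i).valMinAbs.natAbs) : ℕ) : ℝ))) ^ (2 * j) ≤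
        ∑ i : Fin d₁, (κ * ((x.1 i).valMinAbs.natAbs : ℝ)) ^ (2 * j) + ∑ i : Fin d₂, ((x.2 i).valMinAbs.natAbs : ℝ) ^ (2 * j) := by
    intro x hx
    have h1 := (mem_filter.1 hx).2
    have hA0 : 0 ≤ ∑ i : Fin d₁, (κ * ((x.1 i).valMinAbs.natAbs : ℝ)) ^ (2 * j) :=
      sum_nonneg fun i _ => by positivity
    have hB0 : 0 ≤ ∑ i : Fin d₂, ((x.2 i).valMinAbs.natAbs : ℝ) ^ (2 * j) := sum_nonneg fun i _ => by positivity
    rcases le_total (κ * (((univ : Finset (Fin d₁)).sup (fun i => (x.1 i).valMinAbs.natAbs) : ℕ) : ℝ))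
        ((((univ : Finset (Fin d₂)).sup (fun i => (x.2 i).valMinAbs.natAbs) : ℕ) : ℝ)) with hle | hle
    · rw [max_eq_right hle] at h1 ⊢
      exact (sup_pow_le_sum_pow_of_pos x.2 (2 * j) one_pos h1).trans (le_add_of_nonneg_left hA0)
    · rw [max_eq_left hle] at h1 ⊢
      have hsup : 1 / κ ≤ (((univ : Finset (Fin d₁)).sup (fun i => (x.1 i).valMinAbs.natAbs) : ℕ) : ℝ) := by
        rw [div_le_iff₀ hκ0, mul_comm]; exact h1
      have h := sup_pow_le_sum_pow_of_pos x.1 (2 * j) (by positivity) hsup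
      calc (κ * (((univ : Finset (Fin d₁)).sup (fun i => (x.1 i).valMinAbs.natAbs) : ℕ) : ℝ)) ^ (2 * j)
          = κ ^ (2 * j) * ((((univ : Finset (Fin d₁)).sup (fun i => (x.1 i).valMinAbs.natAbs) : ℕ) : ℝ)) ^ (2 * j) :=
            mul_pow _ _ _
        _ ≤ κ ^ (2 * j) * ∑ i : Fin d₁, ((x.1 i).valMinAbs.natAbs : ℝ) ^ (2 * j) :=
            mul_le_mul_of_nonneg_left h (by positivity)
        _ = ∑ i : Fin d₁, (κ * ((x.1 i).valMinAbs.natAbs : ℝ)) ^ (2 * j) := by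
            rw [mul_sum]; exact sum_congr rfl fun i _ => (mul_pow _ _ _).symm
        _ ≤ _ := le_add_of_nonneg_right hB0
  -- the two one-factor rearrangements `Σ_{(a,b)} (Σ_i w_i) N = Σ_i Σ_a Σ_b w_i N`
  have hsplitA : ∑ x : TorusSite d₁ L₁ × TorusSite d₂ L₂,
      (∑ i : Fin d₁, (κ * ((x.1 i).valMinAbs.natAbs : ℝ)) ^ (2 * j)) *
        ‖∑ p, ∑ p', torusChar p x.1 * torusChar p' x.2 * G p p'‖ ^ 2 =
      ∑ i : Fin d₁, ∑ a : TorusSite d₁ L₁, ∑ b : TorusSite d₂ L₂,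
        (κ * ((a i).valMinAbs.natAbs : ℝ)) ^ (2 * j) * ‖∑ p, ∑ p', torusChar p a * torusChar p' b * G p p'‖ ^ 2 := by
    rw [Fintype.sum_prod_type]
    simp only [sum_mul]
    exact (sum_congr rfl fun a _ => sum_comm).trans sum_comm
  have hsplitB : ∑ x : TorusSite d₁ L₁ × TorusSite d₂ L₂,
      (∑ i : Fin d₂, ((x.2 i).valMinAbs.natAbs : ℝ) ^ (2 * j)) *
        ‖∑ p, ∑ p', torusChar p x.1 * torusChar p' x.2 * G p p'‖ ^ 2 =
      ∑ i : Fin d₂, ∑ a : TorusSite d₁ L₁, ∑ b : TorusSite d₂ L₂,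
        ((b i).valMinAbs.natAbs : ℝ) ^ (2 * j) * ‖∑ p, ∑ p', torusChar p a * torusChar p' b * G p p'‖ ^ 2 := by
    rw [Fintype.sum_prod_type]
    simp only [sum_mul]
    exact (sum_congr rfl fun a _ => sum_comm).trans sum_comm
  calc ∑ x ∈ (univ : Finset (TorusSite d₁ L₁ × TorusSite d₂ L₂)).filter (fun x => (1 : ℝ) ≤
        max (κ * (((univ : Finset (Fin d₁)).sup (fun i => (x.1 i).valMinAbs.natAbs) : ℕ) : ℝ))
          ((((univ : Finset (Fin d₂)).sup (fun i => (x.2 i).valMinAbs.natAbs) : ℕ) : ℝ))),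
      κ ^ d₁ * (max (κ * (((univ : Finset (Fin d₁)).sup (fun i => (x.1 i).valMinAbs.natAbs) : ℕ) : ℝ))
          ((((univ : Finset (Fin d₂)).sup (fun i => (x.2 i).valMinAbs.natAbs) : ℕ) : ℝ))) ^ (2 * j) *
        ‖∑ p, ∑ p', torusChar p x.1 * torusChar p' x.2 * G p p'‖ ^ 2
      ≤ ∑ x ∈ (univ : Finset (TorusSite d₁ L₁ × TorusSite d₂ L₂)).filter (fun x => (1 : ℝ) ≤
          max (κ * (((univ : Finset (Fin d₁)).sup (fun i => (x.1 i).valMinAbs.natAbs) : ℕ) : ℝ))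
            ((((univ : Finset (Fin d₂)).sup (fun i => (x.2 i).valMinAbs.natAbs) : ℕ) : ℝ))),
          κ ^ d₁ * (∑ i : Fin d₁, (κ * ((x.1 i).valMinAbs.natAbs : ℝ)) ^ (2 * j) +
              ∑ i : Fin d₂, ((x.2 i).valMinAbs.natAbs : ℝ) ^ (2 * j)) *
            ‖∑ p, ∑ p', torusChar p x.1 * torusChar p' x.2 * G p p'‖ ^ 2 := by
        refine sum_le_sum fun x hx => ?_
        exact mul_le_mul_of_nonneg_right (mul_le_mul_of_nonneg_left (hpt x hx) (by positivity)) (sq_nonneg _)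
    _ ≤ ∑ x : TorusSite d₁ L₁ × TorusSite d₂ L₂,
          κ ^ d₁ * (∑ i : Fin d₁, (κ * ((x.1 i).valMinAbs.natAbs : ℝ)) ^ (2 * j) +
              ∑ i : Fin d₂, ((x.2 i).valMinAbs.natAbs : ℝ) ^ (2 * j)) *
            ‖∑ p, ∑ p', torusChar p x.1 * torusChar p' x.2 * G p p'‖ ^ 2 :=
        sum_le_sum_of_subset_of_nonneg (filter_subset _ _) fun x _ _ => by positivity
    _ = κ ^ d₁ * (∑ x : TorusSite d₁ L₁ × TorusSite d₂ L₂,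
            (∑ i : Fin d₁, (κ * ((x.1 i).valMinAbs.natAbs : ℝ)) ^ (2 * j)) *
              ‖∑ p, ∑ p', torusChar p x.1 * torusChar p' x.2 * G p p'‖ ^ 2 +
          ∑ x : TorusSite d₁ L₁ × TorusSite d₂ L₂,
            (∑ i : Fin d₂, ((x.2 i).valMinAbs.natAbs : ℝ) ^ (2 * j)) *
              ‖∑ p, ∑ p', torusChar p x.1 * torusChar p' x.2 * G p p'‖ ^ 2) := by
        rw [← sum_add_distrib, mul_sum]
        exact sum_congr rfl fun x _ => by ring
    _ ≤ κ ^ d₁ * (∑ i : Fin d₁, (κ * L₁ / 4) ^ (2 * j) *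
            ((L₁ : ℝ) ^ d₁ * (L₂ : ℝ) ^ d₂ * ∑ p, ∑ p', ‖((fwdDiff (Pi.single i 1))^[j] (fun q => G q p')) p‖ ^ 2) +
          ∑ i : Fin d₂, ((L₂ : ℝ) / 4) ^ (2 * j) *
            ((L₁ : ℝ) ^ d₁ * (L₂ : ℝ) ^ d₂ * ∑ p, ∑ p', ‖((fwdDiff (Pi.single i 1))^[j] (G p)) p'‖ ^ 2)) := by
        rw [hsplitA, hsplitB]
        refine mul_le_mul_of_nonneg_left (add_le_add (sum_le_sum fun i _ => ?_) (sum_le_sum fun i _ => ?_))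
          (by positivity)
        · exact sum_sum_pow_valMinAbs_fst_mul_norm_sq_le G hκ0.le i j
        · exact sum_sum_pow_valMinAbs_snd_mul_norm_sq_le G i j
    _ = _ := by
        simp only [← Finset.mul_sum]
        ring

/-- The tail constant in the currency of the abstract lemma: `Σ_{r ≥ 1} κ^{d₁} r^{2j} ‖S‖² ≤ (√(κ^{d₁}L₁^{d₁}L₂^{d₂})·T)²`
once `(κL₁/4)^{2j} Σ_i ‖Δ^{j}_{(e_i,0)} G‖² + (L₂/4)^{2j} Σ_i ‖Δ^{j}_{(0,e_i)} G‖² ≤ T²`. [cite: Katznelson2004, Ch. I §6.3,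
(6.4)] -/
private theorem prod_tail_le (G : TorusSite d₁ L₁ → TorusSite d₂ L₂ → ℂ) {κ : ℝ} (hκ0 : 0 < κ) (j : ℕ) {T : ℝ}
    (htail : (κ * L₁ / 4) ^ (2 * j) * ∑ i : Fin d₁, ∑ p, ∑ p', ‖((fwdDiff (Pi.single i 1))^[j] (fun q => G q p')) p‖ ^ 2 +
        ((L₂ : ℝ) / 4) ^ (2 * j) * ∑ i : Fin d₂, ∑ p, ∑ p', ‖((fwdDiff (Pi.single i 1))^[j] (G p)) p'‖ ^ 2 ≤ T ^ 2) :
    ∑ x ∈ (univ : Finset (TorusSite d₁ L₁ × TorusSite d₂ L₂)).filter (fun x => (1 : ℝ) ≤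
        max (κ * (((univ : Finset (Fin d₁)).sup (fun i => (x.1 i).valMinAbs.natAbs) : ℕ) : ℝ))
          ((((univ : Finset (Fin d₂)).sup (fun i => (x.2 i).valMinAbs.natAbs) : ℕ) : ℝ))),
      κ ^ d₁ * (max (κ * (((univ : Finset (Fin d₁)).sup (fun i => (x.1 i).valMinAbs.natAbs) : ℕ) : ℝ))
          ((((univ : Finset (Fin d₂)).sup (fun i => (x.2 i).valMinAbs.natAbs) : ℕ) : ℝ))) ^ (2 * j) *
        ‖∑ p, ∑ p', torusChar p x.1 * torusChar p' x.2 * G p p'‖ ^ 2 ≤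
      (Real.sqrt (κ ^ d₁ * ((L₁ : ℝ) ^ d₁ * (L₂ : ℝ) ^ d₂)) * T) ^ 2 := by
  refine (sum_filter_prodRadius_pow_mul_norm_sq_le G hκ0 j).trans ?_
  rw [mul_pow, Real.sq_sqrt (by positivity)]
  exact mul_le_mul_of_nonneg_left htail (by positivity)

/-- `(κ^{d₁})⁻¹ √(κ^{d₁} V) = √(V/κ^{d₁})`. [folklore] -/
private theorem inv_mul_sqrt_mul_eq {k V : ℝ} (hk : 0 < k) (hV : 0 ≤ V) : k⁻¹ * Real.sqrt (k * V) = Real.sqrt (V / k) := by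
  rw [← Real.sqrt_sq (by positivity : 0 ≤ k⁻¹ * Real.sqrt (k * V)), mul_pow, Real.sq_sqrt (by positivity)]
  congr 1
  field_simp

/-- **Bernstein's theorem on a product of discrete tori (`ℓ²` form, over `{r ≥ 1}`).**  Let
`S(a,b) = Σ_{p,p'} χ_p(a) χ_{p'}(b) G(p,p')` on `(ℤ/L₁ℤ)^{d₁} × (ℤ/L₂ℤ)^{d₂}`, `0 < κ ≤ 1` the mesh ratio of the first factor,
`r(a,b) = max(κ|ã|_∞, |b̃|_∞)`, `d = d₁ + d₂`, and `j₁ < a + d/2 < j₂` symmetric (`2j₁ + m = 2a + d = 2j₂ - m`, `m ≥ 1`).  If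
`(κL₁/4)^{2j} Σ_i ‖Δ^{j}_{(e_i,0)} G‖²_{ℓ²} + (L₂/4)^{2j} Σ_i ‖Δ^{j}_{(0,e_i)} G‖²_{ℓ²} ≤ T_j²` for `j = j₁, j₂`, then, `θ = √2`,
`Σ_{r ≥ 1} r^a ‖S(a,b)‖ ≤ 2 θ^{2a+d} θ^m/(θ^m-1) · √(3^d) · √(L₁^{d₁} L₂^{d₂}/κ^{d₁}) · √(T_{j₁} T_{j₂})`.
[cite: Katznelson2004, Ch. I §6.3, Theorem (Bernstein), pp. 57–58] -/
theorem sum_prodRadius_pow_mul_norm_le_sqrt (G : TorusSite d₁ L₁ → TorusSite d₂ L₂ → ℂ) {κ : ℝ} (hκ0 : 0 < κ)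
    (hκ1 : κ ≤ 1) {a j₁ j₂ m : ℕ} (hm₁ : 2 * j₁ + m = 2 * a + (d₁ + d₂)) (hm₂ : 2 * a + (d₁ + d₂) + m = 2 * j₂)
    (hm0 : 0 < m) {T₁ T₂ : ℝ} (hT₁ : 0 ≤ T₁) (hT₂ : 0 ≤ T₂)
    (htail₁ : (κ * L₁ / 4) ^ (2 * j₁) * ∑ i : Fin d₁, ∑ p, ∑ p', ‖((fwdDiff (Pi.single i 1))^[j₁] (fun q => G q p')) p‖ ^ 2 +
        ((L₂ : ℝ) / 4) ^ (2 * j₁) * ∑ i : Fin d₂, ∑ p, ∑ p', ‖((fwdDiff (Pi.single i 1))^[j₁] (G p)) p'‖ ^ 2 ≤ T₁ ^ 2)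
    (htail₂ : (κ * L₁ / 4) ^ (2 * j₂) * ∑ i : Fin d₁, ∑ p, ∑ p', ‖((fwdDiff (Pi.single i 1))^[j₂] (fun q => G q p')) p‖ ^ 2 +
        ((L₂ : ℝ) / 4) ^ (2 * j₂) * ∑ i : Fin d₂, ∑ p, ∑ p', ‖((fwdDiff (Pi.single i 1))^[j₂] (G p)) p'‖ ^ 2 ≤ T₂ ^ 2) :
    ∑ x ∈ (univ : Finset (TorusSite d₁ L₁ × TorusSite d₂ L₂)).filter (fun x => (1 : ℝ) ≤
        max (κ * (((univ : Finset (Fin d₁)).sup (fun i => (x.1 i).valMinAbs.natAbs) : ℕ) : ℝ))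
          ((((univ : Finset (Fin d₂)).sup (fun i => (x.2 i).valMinAbs.natAbs) : ℕ) : ℝ))),
      (max (κ * (((univ : Finset (Fin d₁)).sup (fun i => (x.1 i).valMinAbs.natAbs) : ℕ) : ℝ))
          ((((univ : Finset (Fin d₂)).sup (fun i => (x.2 i).valMinAbs.natAbs) : ℕ) : ℝ))) ^ a *
        ‖∑ p, ∑ p', torusChar p x.1 * torusChar p' x.2 * G p p'‖ ≤
      2 * Real.sqrt 2 ^ (2 * a + (d₁ + d₂)) * (Real.sqrt 2 ^ m / (Real.sqrt 2 ^ m - 1)) * Real.sqrt ((3 : ℝ) ^ (d₁ + d₂)) *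
        Real.sqrt ((L₁ : ℝ) ^ d₁ * (L₂ : ℝ) ^ d₂ / κ ^ d₁) * Real.sqrt (T₁ * T₂) := by
  set V : ℝ := (L₁ : ℝ) ^ d₁ * (L₂ : ℝ) ^ d₂ with hV
  have hV0 : 0 ≤ V := by positivity
  have hk : 0 < κ ^ d₁ := pow_pos hκ0 _
  have hmain := sum_mul_pow_mul_le_sqrt (univ : Finset (TorusSite d₁ L₁ × TorusSite d₂ L₂)) (fun _ => κ ^ d₁)
    (fun x => ‖∑ p, ∑ p', torusChar p x.1 * torusChar p' x.2 * G p p'‖)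
    (fun x => max (κ * (((univ : Finset (Fin d₁)).sup (fun i => (x.1 i).valMinAbs.natAbs) : ℕ) : ℝ))
      ((((univ : Finset (Fin d₂)).sup (fun i => (x.2 i).valMinAbs.natAbs) : ℕ) : ℝ)))
    (fun _ _ => hk.le) (fun _ _ => norm_nonneg _) (fun _ _ => le_max_of_le_right (Nat.cast_nonneg _)) hm₁ hm₂ hm0
    (A := (3 : ℝ) ^ (d₁ + d₂)) (by positivity)
    (by positivity : 0 ≤ Real.sqrt (κ ^ d₁ * V) * T₁) (by positivity : 0 ≤ Real.sqrt (κ ^ d₁ * V) * T₂)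
    (fun R hR => by rw [sum_const, nsmul_eq_mul]; exact card_filter_prodRadius_lt_mul_le hκ0 hκ1 hR)
    (prod_tail_le G hκ0 j₁ htail₁) (prod_tail_le G hκ0 j₂ htail₂)
  -- divide by `κ^{d₁}` and simplify `√(B₁B₂)`
  have hBB : Real.sqrt (Real.sqrt (κ ^ d₁ * V) * T₁ * (Real.sqrt (κ ^ d₁ * V) * T₂)) =
      Real.sqrt (κ ^ d₁ * V) * Real.sqrt (T₁ * T₂) := by
    rw [show Real.sqrt (κ ^ d₁ * V) * T₁ * (Real.sqrt (κ ^ d₁ * V) * T₂) = Real.sqrt (κ ^ d₁ * V) ^ 2 * (T₁ * T₂) by ring,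
      Real.sqrt_mul (by positivity), Real.sqrt_sq (Real.sqrt_nonneg _)]
  rw [hBB] at hmain
  have hlhs : ∑ x ∈ (univ : Finset (TorusSite d₁ L₁ × TorusSite d₂ L₂)).filter (fun x => (1 : ℝ) ≤
        max (κ * (((univ : Finset (Fin d₁)).sup (fun i => (x.1 i).valMinAbs.natAbs) : ℕ) : ℝ))
          ((((univ : Finset (Fin d₂)).sup (fun i => (x.2 i).valMinAbs.natAbs) : ℕ) : ℝ))),
      (max (κ * (((univ : Finset (Fin d₁)).sup (fun i => (x.1 i).valMinAbs.natAbs) : ℕ) : ℝ))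
          ((((univ : Finset (Fin d₂)).sup (fun i => (x.2 i).valMinAbs.natAbs) : ℕ) : ℝ))) ^ a *
        ‖∑ p, ∑ p', torusChar p x.1 * torusChar p' x.2 * G p p'‖ =
      (κ ^ d₁)⁻¹ * ∑ x ∈ (univ : Finset (TorusSite d₁ L₁ × TorusSite d₂ L₂)).filter (fun x => (1 : ℝ) ≤
        max (κ * (((univ : Finset (Fin d₁)).sup (fun i => (x.1 i).valMinAbs.natAbs) : ℕ) : ℝ))
          ((((univ : Finset (Fin d₂)).sup (fun i => (x.2 i).valMinAbs.natAbs) : ℕ) : ℝ))),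
        κ ^ d₁ * (max (κ * (((univ : Finset (Fin d₁)).sup (fun i => (x.1 i).valMinAbs.natAbs) : ℕ) : ℝ))
          ((((univ : Finset (Fin d₂)).sup (fun i => (x.2 i).valMinAbs.natAbs) : ℕ) : ℝ))) ^ a *
        ‖∑ p, ∑ p', torusChar p x.1 * torusChar p' x.2 * G p p'‖ := by
    rw [mul_sum]
    refine sum_congr rfl fun x _ => ?_
    rw [← mul_assoc, ← mul_assoc, inv_mul_cancel₀ hk.ne', one_mul]
  rw [hlhs]
  calc (κ ^ d₁)⁻¹ * _ ≤ (κ ^ d₁)⁻¹ * (2 * Real.sqrt 2 ^ (2 * a + (d₁ + d₂)) * (Real.sqrt 2 ^ m / (Real.sqrt 2 ^ m - 1)) *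
        Real.sqrt ((3 : ℝ) ^ (d₁ + d₂)) * (Real.sqrt (κ ^ d₁ * V) * Real.sqrt (T₁ * T₂))) :=
        mul_le_mul_of_nonneg_left hmain (by positivity)
    _ = 2 * Real.sqrt 2 ^ (2 * a + (d₁ + d₂)) * (Real.sqrt 2 ^ m / (Real.sqrt 2 ^ m - 1)) *
        Real.sqrt ((3 : ℝ) ^ (d₁ + d₂)) * ((κ ^ d₁)⁻¹ * Real.sqrt (κ ^ d₁ * V)) * Real.sqrt (T₁ * T₂) := by ring
    _ = _ := by rw [inv_mul_sqrt_mul_eq hk hV0]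

/-- **Bernstein's theorem on a product of discrete tori, FULL sum.**  As `sum_prodRadius_pow_mul_norm_le_sqrt`, plus the
near region `{r < 1}` (first-factor separations shorter than one step of the second factor) paid by the plain `ℓ²` size
`Σ_{p,p'} ‖G(p,p')‖² ≤ T₀²`:
`Σ_{a,b} r^a ‖S(a,b)‖ ≤ √(3^d) · √(L₁^{d₁} L₂^{d₂}/κ^{d₁}) · (T₀ + 2 θ^{2a+d} θ^m/(θ^m-1) √(T_{j₁} T_{j₂}))`, `θ = √2`.
[cite: Katznelson2004, Ch. I §6.3, Theorem (Bernstein), pp. 57–58] -/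
theorem sum_prodRadius_pow_mul_norm_le_sqrt_add (G : TorusSite d₁ L₁ → TorusSite d₂ L₂ → ℂ) {κ : ℝ} (hκ0 : 0 < κ)
    (hκ1 : κ ≤ 1) {a j₁ j₂ m : ℕ} (hm₁ : 2 * j₁ + m = 2 * a + (d₁ + d₂)) (hm₂ : 2 * a + (d₁ + d₂) + m = 2 * j₂)
    (hm0 : 0 < m) {T₀ T₁ T₂ : ℝ} (hT₀ : 0 ≤ T₀) (hT₁ : 0 ≤ T₁) (hT₂ : 0 ≤ T₂)
    (hℓ2 : ∑ p : TorusSite d₁ L₁, ∑ p' : TorusSite d₂ L₂, ‖G p p'‖ ^ 2 ≤ T₀ ^ 2)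
    (htail₁ : (κ * L₁ / 4) ^ (2 * j₁) * ∑ i : Fin d₁, ∑ p, ∑ p', ‖((fwdDiff (Pi.single i 1))^[j₁] (fun q => G q p')) p‖ ^ 2 +
        ((L₂ : ℝ) / 4) ^ (2 * j₁) * ∑ i : Fin d₂, ∑ p, ∑ p', ‖((fwdDiff (Pi.single i 1))^[j₁] (G p)) p'‖ ^ 2 ≤ T₁ ^ 2)
    (htail₂ : (κ * L₁ / 4) ^ (2 * j₂) * ∑ i : Fin d₁, ∑ p, ∑ p', ‖((fwdDiff (Pi.single i 1))^[j₂] (fun q => G q p')) p‖ ^ 2 +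
        ((L₂ : ℝ) / 4) ^ (2 * j₂) * ∑ i : Fin d₂, ∑ p, ∑ p', ‖((fwdDiff (Pi.single i 1))^[j₂] (G p)) p'‖ ^ 2 ≤ T₂ ^ 2) :
    ∑ x : TorusSite d₁ L₁ × TorusSite d₂ L₂,
      (max (κ * (((univ : Finset (Fin d₁)).sup (fun i => (x.1 i).valMinAbs.natAbs) : ℕ) : ℝ))
          ((((univ : Finset (Fin d₂)).sup (fun i => (x.2 i).valMinAbs.natAbs) : ℕ) : ℝ))) ^ a *
        ‖∑ p, ∑ p', torusChar p x.1 * torusChar p' x.2 * G p p'‖ ≤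
      Real.sqrt ((3 : ℝ) ^ (d₁ + d₂)) * Real.sqrt ((L₁ : ℝ) ^ d₁ * (L₂ : ℝ) ^ d₂ / κ ^ d₁) *
        (T₀ + 2 * Real.sqrt 2 ^ (2 * a + (d₁ + d₂)) * (Real.sqrt 2 ^ m / (Real.sqrt 2 ^ m - 1)) * Real.sqrt (T₁ * T₂)) := by
  set V : ℝ := (L₁ : ℝ) ^ d₁ * (L₂ : ℝ) ^ d₂ with hV
  have hV0 : 0 ≤ V := by positivity
  have hk : 0 < κ ^ d₁ := pow_pos hκ0 _
  have hB₀ : ∑ x ∈ (univ : Finset (TorusSite d₁ L₁ × TorusSite d₂ L₂)),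
      κ ^ d₁ * ‖∑ p, ∑ p', torusChar p x.1 * torusChar p' x.2 * G p p'‖ ^ 2 ≤ (Real.sqrt (κ ^ d₁ * V) * T₀) ^ 2 := by
    rw [← mul_sum, Fintype.sum_prod_type, sum_sum_norm_sq_prodChar G, mul_pow, Real.sq_sqrt (by positivity), ← hV]
    calc κ ^ d₁ * (V * ∑ p, ∑ p', ‖G p p'‖ ^ 2) ≤ κ ^ d₁ * (V * T₀ ^ 2) :=
          mul_le_mul_of_nonneg_left (mul_le_mul_of_nonneg_left hℓ2 hV0) hk.le
      _ = κ ^ d₁ * V * T₀ ^ 2 := by ring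
  have hmain := sum_mul_pow_mul_le_sqrt_add (univ : Finset (TorusSite d₁ L₁ × TorusSite d₂ L₂)) (fun _ => κ ^ d₁)
    (fun x => ‖∑ p, ∑ p', torusChar p x.1 * torusChar p' x.2 * G p p'‖)
    (fun x => max (κ * (((univ : Finset (Fin d₁)).sup (fun i => (x.1 i).valMinAbs.natAbs) : ℕ) : ℝ))
      ((((univ : Finset (Fin d₂)).sup (fun i => (x.2 i).valMinAbs.natAbs) : ℕ) : ℝ)))
    (fun _ _ => hk.le) (fun _ _ => norm_nonneg _) (fun _ _ => le_max_of_le_right (Nat.cast_nonneg _)) hm₁ hm₂ hm0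
    (A := (3 : ℝ) ^ (d₁ + d₂)) (by positivity) (by positivity : 0 ≤ Real.sqrt (κ ^ d₁ * V) * T₀)
    (by positivity : 0 ≤ Real.sqrt (κ ^ d₁ * V) * T₁) (by positivity : 0 ≤ Real.sqrt (κ ^ d₁ * V) * T₂)
    (fun R hR => by rw [sum_const, nsmul_eq_mul]; exact card_filter_prodRadius_lt_mul_le hκ0 hκ1 hR)
    hB₀ (prod_tail_le G hκ0 j₁ htail₁) (prod_tail_le G hκ0 j₂ htail₂)
  have hBB : Real.sqrt (Real.sqrt (κ ^ d₁ * V) * T₁ * (Real.sqrt (κ ^ d₁ * V) * T₂)) =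
      Real.sqrt (κ ^ d₁ * V) * Real.sqrt (T₁ * T₂) := by
    rw [show Real.sqrt (κ ^ d₁ * V) * T₁ * (Real.sqrt (κ ^ d₁ * V) * T₂) = Real.sqrt (κ ^ d₁ * V) ^ 2 * (T₁ * T₂) by ring,
      Real.sqrt_mul (by positivity), Real.sqrt_sq (Real.sqrt_nonneg _)]
  rw [hBB] at hmain
  have hlhs : ∑ x : TorusSite d₁ L₁ × TorusSite d₂ L₂,
      (max (κ * (((univ : Finset (Fin d₁)).sup (fun i => (x.1 i).valMinAbs.natAbs) : ℕ) : ℝ))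
          ((((univ : Finset (Fin d₂)).sup (fun i => (x.2 i).valMinAbs.natAbs) : ℕ) : ℝ))) ^ a *
        ‖∑ p, ∑ p', torusChar p x.1 * torusChar p' x.2 * G p p'‖ =
      (κ ^ d₁)⁻¹ * ∑ x : TorusSite d₁ L₁ × TorusSite d₂ L₂,
        κ ^ d₁ * (max (κ * (((univ : Finset (Fin d₁)).sup (fun i => (x.1 i).valMinAbs.natAbs) : ℕ) : ℝ))
          ((((univ : Finset (Fin d₂)).sup (fun i => (x.2 i).valMinAbs.natAbs) : ℕ) : ℝ))) ^ a *
        ‖∑ p, ∑ p', torusChar p x.1 * torusChar p' x.2 * G p p'‖ := by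
    rw [mul_sum]
    refine sum_congr rfl fun x _ => ?_
    rw [← mul_assoc, ← mul_assoc, inv_mul_cancel₀ hk.ne', one_mul]
  rw [hlhs]
  calc (κ ^ d₁)⁻¹ * _ ≤ (κ ^ d₁)⁻¹ * (Real.sqrt ((3 : ℝ) ^ (d₁ + d₂)) * (Real.sqrt (κ ^ d₁ * V) * T₀ +
        2 * Real.sqrt 2 ^ (2 * a + (d₁ + d₂)) * (Real.sqrt 2 ^ m / (Real.sqrt 2 ^ m - 1)) *
          (Real.sqrt (κ ^ d₁ * V) * Real.sqrt (T₁ * T₂)))) :=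
        mul_le_mul_of_nonneg_left hmain (by positivity)
    _ = Real.sqrt ((3 : ℝ) ^ (d₁ + d₂)) * ((κ ^ d₁)⁻¹ * Real.sqrt (κ ^ d₁ * V)) *
        (T₀ + 2 * Real.sqrt 2 ^ (2 * a + (d₁ + d₂)) * (Real.sqrt 2 ^ m / (Real.sqrt 2 ^ m - 1)) * Real.sqrt (T₁ * T₂)) := by
        ring
    _ = _ := by rw [inv_mul_sqrt_mul_eq hk hV0]

end Prod

end Literature.Probability.LatticeModels

end
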